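import Summits.BirchSwinnertonDyer.BirchSwinnertonDyer.Theorems.ManinLocalTwoThreeEtaIdentityReductionThirtySix
import HarnessLib

/-!
# Level 20 — the first non-CM level: `η`-parametrisation of `X₀(20) = 20a1`, reduction of its
# identities to three `q`-asymptotics, and the Néron squeeze

Cell bsd-f2-manin, route `ManinLocalTwoThree` (crux C2 `ManinOddAtFour`: `4 ∣ 20`).  `X₀(20)` has genus
one and NO complex multiplication, so the `ℤ[ω]`/`ℤ[i]`-squeezes of the levels `27, 32, 36` are not
available; instead (planner -an g50, MEMO-an §95) the tree's Néron-scaling fact gives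
`NeronSqueeze.abs_maninConstant_eq_one_of_periodLattice_le`: it suffices to put the period lattice of
the newform inside the Néron lattice of ONE explicit globally minimal curve.  Objects:

* `φ₂₀ = η(2τ)²η(10τ)²` (`cuspFormEtaProductTwenty`; `S₂(Γ₀(20)) = ℂφ₂₀`, so `D.f = φ₂₀` for every
  `X₀(20)`-datum, §1);
* `x = η(4τ)η(10τ)⁵/(η(2τ)η(20τ)⁵) = q⁻² + 1 + q² + …`, `y = η(4τ)η(5τ)⁵/(η(τ)η(20τ)⁵) = q⁻³ + q⁻² + 2q⁻¹ + …`
  (weight-`0` Newman quotients on `Γ₀(20)`, holomorphic off the cusp `∞`, §2), which satisfy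
  `y² − 2xy − 4y = x³` — the Weierstrass model `W₀ = [−2, 0, −4, 0, 0]` with `c₄ = −176`, `c₆ = −2368`,
  `Δ = −6400`, the invariants of Cremona's `20a1`, globally minimal (§5) — and `x′ = −2πiφ₂₀(2y − 2x − 4)`.

§3: the three limits (T1)₂₀ `((2πi)⁻¹x′ + φ₂₀(2y − 2x − 4))/q → 0`, (T2)₂₀
`((2πi)⁻¹y′ + φ₂₀(3x² + 2y))/q → 0`, (T3)₂₀ `y² − 2xy − 4y − x³ → 0` at `i∞` give the identities (cusp-form
argument `EtaIdentityReductionThirtySix.deriv_eq_of_tendsto_of`, zero derivative of the cubic).  The sequel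
`ManinLocalTwoThreeNeronSqueezeTwenty` derives (S2)₂₀ and the Néron squeeze.  BSD is not proved by this.
-/

set_option autoImplicit false
set_option linter.dupNamespace false

noncomputable section

open Complex Filter Topology Set Function Asymptotics
open UpperHalfPlane hiding I
open scoped Real Topology Manifold MatrixGroups ModularForm
open ModularForm CongruenceSubgroup
open Literature.NumberTheory.EllipticCurves Literature.NumberTheory.EllipticCurves.ModularForms
open Summit.BirchSwinnertonDyer.BirchSwinnertonDyer.Theorems.ManinLocalTwoThree

namespace Summit.BirchSwinnertonDyer.BirchSwinnertonDyer.Theorems.ManinLocalTwoThree.LevelTwenty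

open CuspToolkit AnalyticBridge EtaIdentityReduction EtaIdentityReductionThirtySix

/-! ## §1 `D.f = φ₂₀` for every `X₀(20)`-datum (FACT-FREE) -/

/-- `η(2τ)²η(10τ)²` as the `η`-quotient of level `20` with exponents `r₂ = r₁₀ = 2`. [cite: Koehler2011, §1] -/
theorem etaQuotient_eq_etaProductTwenty (τ : ℍ) :
    etaQuotient 20 (expFn [(2, 2), (10, 2)]) τ = etaProductTwenty τ := by
  have h : etaQuotient 20 (expFn [(2, 2), (10, 2)]) τ = η (2 * (τ : ℂ)) ^ 2 * η (10 * (τ : ℂ)) ^ 2 := by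
    rw [etaQuotient_apply, show Nat.divisors 20 = {1, 2, 4, 5, 10, 20} by decide]
    rw [Finset.prod_insert (by decide), Finset.prod_insert (by decide), Finset.prod_insert (by decide),
      Finset.prod_insert (by decide), Finset.prod_insert (by decide), Finset.prod_singleton]
    rw [show expFn [(2, 2), (10, 2)] 1 = 0 by decide, show expFn [(2, 2), (10, 2)] 2 = 2 by decide,
      show expFn [(2, 2), (10, 2)] 4 = 0 by decide, show expFn [(2, 2), (10, 2)] 5 = 0 by decide,
      show expFn [(2, 2), (10, 2)] 10 = 2 by decide, show expFn [(2, 2), (10, 2)] 20 = 0 by decide]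
    simp only [zpow_zero, one_mul, mul_one]
    norm_cast
  rw [h, etaProductTwenty_apply]

/-- **`φ₂₀(τ)/q → 1` at `i∞`** (order `(2·2 + 10·2)/24 = 1`, leading coefficient `1`). [cite: Koehler2011, §1] -/
theorem tendsto_etaProductTwenty_div_qParam :
    Tendsto (fun τ : ℍ ↦ cuspFormEtaProductTwenty τ / Periodic.qParam 1 (τ : ℂ)) atImInfty (𝓝 1) := by
  have h := tendsto_etaQuotient_div_qParam_zpow 20 (expFn [(2, 2), (10, 2)]) 1 (by decide)
  refine h.congr fun τ ↦ ?_
  rw [zpow_one, etaQuotient_eq_etaProductTwenty]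
  rfl

/-- **`a₁(φ₂₀) = 1`.** [cite: CremonaAlgorithms1997, Table 3 (N = 20)] -/
theorem cuspCoeff_one_etaProductTwenty : cuspCoeff cuspFormEtaProductTwenty 1 = 1 :=
  NonVacuityTwentySeven.cuspCoeff_one_eq_of_tendsto _ tendsto_etaProductTwenty_div_qParam

/-- **Every normalised weight-`2` newform on `Γ₀(20)` is `φ₂₀`** (`dim S₂(Γ₀(20)) = 1`).
[cite: CremonaAlgorithms1997, Table 3 (N = 20)] -/
theorem eq_etaProductTwenty_of_isNewform0 {g : CuspForm (Gamma0 20) 2} (hg : IsNewform0 g) :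
    g = cuspFormEtaProductTwenty := by
  obtain ⟨c, hc⟩ := (finrank_eq_one_iff_of_nonzero' cuspFormEtaProductTwenty
    cuspFormEtaProductTwenty_ne_zero).mp finrank_cuspForm_two_eq_genusX0_twenty.2.1 g
  have h1 : cuspCoeff g 1 = 1 := hg.2.2
  have hc1 : c = 1 := by
    have h := congrArg (cuspCoeff · 1) hc
    simp only [cuspCoeff_smul, h1, cuspCoeff_one_etaProductTwenty, mul_one] at h
    exact h
  rw [← hc, hc1, one_smul]

/-- **Every `X₀(20)`-datum of every curve has newform `φ₂₀ = η(2τ)²η(10τ)²`** — FACT-FREE.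
[cite: CremonaAlgorithms1997, Table 3 (N = 20)] -/
theorem f_eq_etaProductTwenty {W : WeierstrassCurve ℚ} (D : ModularParametrizationData W 20) :
    D.f = cuspFormEtaProductTwenty :=
  eq_etaProductTwenty_of_isNewform0 D.isNewformOf.1

/-- **`S ∈ S₂(Γ₀(20))` with `S(τ)/q → 0` at `i∞` is zero.** [folklore] -/
theorem cuspForm_twenty_eq_zero_of_tendsto (S : CuspForm (Gamma0 20) 2)
    (h : Tendsto (fun τ : ℍ ↦ S τ / Periodic.qParam 1 (τ : ℂ)) atImInfty (𝓝 0)) : S = 0 := by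
  obtain ⟨c, hc⟩ := finrank_cuspForm_two_eq_genusX0_twenty.2.2 S
  have hlim : Tendsto (fun τ : ℍ ↦ S τ / Periodic.qParam 1 (τ : ℂ)) atImInfty (𝓝 c) := by
    have := tendsto_etaProductTwenty_div_qParam.const_mul c
    rw [mul_one] at this
    refine this.congr fun τ ↦ ?_
    rw [← hc, CuspForm.IsGLPos.smul_apply, smul_eq_mul, mul_div_assoc]
  have hc0 : c = 0 := tendsto_nhds_unique hlim h
  rw [← hc, hc0, zero_smul]

/-! ## §2 `x`, `y` are `Γ₀(20)`-invariant and bounded at every cusp off `∞` -/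

/-- Newman's conditions for `x = η₂⁻¹η₄η₁₀⁵η₂₀⁻⁵` in weight `0` (`∏ δ^{|r|} = 2·4·10⁵·20⁵ = (2⁹5⁵)²`). [folklore] -/
theorem newmanCond_x20 : NewmanCond 20 (expFn [(2, -1), (4, 1), (10, 5), (20, -5)]) 0 :=
  ⟨by decide, by decide, by decide, ⟨2 ^ 9 * 5 ^ 5, by decide⟩⟩

/-- Newman's conditions for `y = η₁⁻¹η₄η₅⁵η₂₀⁻⁵` in weight `0` (`∏ δ^{|r|} = 4·5⁵·20⁵ = (2⁶5⁵)²`). [folklore] -/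
theorem newmanCond_y20 : NewmanCond 20 (expFn [(1, -1), (4, 1), (5, 5), (20, -5)]) 0 :=
  ⟨by decide, by decide, by decide, ⟨2 ^ 6 * 5 ^ 5, by decide⟩⟩

/-- `x(γτ) = x(τ)` for `γ ∈ Γ₀(20)`. [folklore] -/
theorem x20_smul (γ : Gamma0 20) (τ : ℍ) :
    etaQuotient 20 (expFn [(2, -1), (4, 1), (10, 5), (20, -5)]) ((γ : SL(2, ℤ)) • τ)
      = etaQuotient 20 (expFn [(2, -1), (4, 1), (10, 5), (20, -5)]) τ := by
  have h := etaQuotient_smul_of_mem_Gamma0 20 (by norm_num) _ 0 ⟨0, by simp⟩ newmanCond_x20 γ.2 τ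
  rwa [zpow_zero, one_mul] at h

/-- `y(γτ) = y(τ)` for `γ ∈ Γ₀(20)`. [folklore] -/
theorem y20_smul (γ : Gamma0 20) (τ : ℍ) :
    etaQuotient 20 (expFn [(1, -1), (4, 1), (5, 5), (20, -5)]) ((γ : SL(2, ℤ)) • τ)
      = etaQuotient 20 (expFn [(1, -1), (4, 1), (5, 5), (20, -5)]) τ := by
  have h := etaQuotient_smul_of_mem_Gamma0 20 (by norm_num) _ 0 ⟨0, by simp⟩ newmanCond_y20 γ.2 τ
  rwa [zpow_zero, one_mul] at h

/-- Ligozat's order at level `20` is `≥ 0` at every `c` with `20 ∤ c`, given the values at the proper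
divisors. [cite: Ligozat1975, Ch. 3] -/
theorem cuspOrder24_nonneg_of_not_dvd20 (r : ℕ → ℤ)
    (h : ∀ t ∈ Nat.divisors 20, t ≠ 20 → 0 ≤ cuspOrder24 20 r t) {c : ℤ} (hc : ¬ (20 : ℤ) ∣ c) :
    0 ≤ cuspOrder24 20 r c := by
  rw [cuspOrder24_eq_gcd]
  refine h _ (Nat.mem_divisors.mpr ⟨Nat.gcd_dvd_left _ _, by norm_num⟩) fun h20 ↦ hc ?_
  have h20' : (20 : ℕ) ∣ c.natAbs := h20 ▸ Nat.gcd_dvd_right _ _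
  exact Int.natCast_dvd.mpr h20'

/-- `γ ∉ Γ₀(20)` ⟹ `20 ∤ c(γ)`. [folklore] -/
theorem not_dvd_of_not_mem20 {γ : SL(2, ℤ)} (hγ : γ ∉ Gamma0 20) : ¬ (20 : ℤ) ∣ γ 1 0 := by
  intro h
  apply hγ
  rw [Gamma0_mem]
  exact (ZMod.intCast_zmod_eq_zero_iff_dvd _ 20).mpr h

/-- `x ∘ γ` is bounded at `i∞` for `γ ∉ Γ₀(20)` (Ligozat: zeros at the cusps `1/5`, `1/10`). [cite: Ligozat1975, Ch. 3] -/
theorem isBoundedAtImInfty_x20_smul {γ : SL(2, ℤ)} (hγ : γ ∉ Gamma0 20) :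
    IsBoundedAtImInfty (fun τ : ℍ ↦ etaQuotient 20 (expFn [(2, -1), (4, 1), (10, 5), (20, -5)]) (γ • τ)) :=
  isBoundedAtImInfty_etaQuotient_smul 20 (by norm_num) _ (by decide) γ
    (cuspOrder24_nonneg_of_not_dvd20 _ (by decide) (not_dvd_of_not_mem20 hγ))

/-- `y ∘ γ` is bounded at `i∞` for `γ ∉ Γ₀(20)` (Ligozat: triple zero at the cusp `1/5`). [cite: Ligozat1975, Ch. 3] -/
theorem isBoundedAtImInfty_y20_smul {γ : SL(2, ℤ)} (hγ : γ ∉ Gamma0 20) :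
    IsBoundedAtImInfty (fun τ : ℍ ↦ etaQuotient 20 (expFn [(1, -1), (4, 1), (5, 5), (20, -5)]) (γ • τ)) :=
  isBoundedAtImInfty_etaQuotient_smul 20 (by norm_num) _ (by decide) γ
    (cuspOrder24_nonneg_of_not_dvd20 _ (by decide) (not_dvd_of_not_mem20 hγ))

/-! ## §3 The three limits ⟹ the identities -/

/-- **(I2a) from (T1)₂₀**: `x′ = −2πi φ₂₀ · (2y − 2x − 4)` on `ℍ`. [folklore] -/
theorem deriv_x20_of_tendsto
    (hT1 : Tendsto (fun τ : ℍ ↦ ((2 * π * I)⁻¹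
      * deriv (etaQuotient 20 (expFn [(2, -1), (4, 1), (10, 5), (20, -5)]) ∘ ofComplex) τ
      + cuspFormEtaProductTwenty τ * (2 * etaQuotient 20 (expFn [(1, -1), (4, 1), (5, 5), (20, -5)]) τ
        - 2 * etaQuotient 20 (expFn [(2, -1), (4, 1), (10, 5), (20, -5)]) τ - 4))
      / Function.Periodic.qParam 1 (τ : ℂ)) atImInfty (𝓝 0)) :
    ∀ τ : ℍ, deriv (etaQuotient 20 (expFn [(2, -1), (4, 1), (10, 5), (20, -5)]) ∘ ofComplex) τ
      = -(2 * π * I * cuspFormEtaProductTwenty τ)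
          * (2 * etaQuotient 20 (expFn [(1, -1), (4, 1), (5, 5), (20, -5)]) τ
            - 2 * etaQuotient 20 (expFn [(2, -1), (4, 1), (10, 5), (20, -5)]) τ - 4) := by
  refine deriv_eq_of_tendsto_of cuspFormEtaProductTwenty cuspForm_twenty_eq_zero_of_tendsto _
    (fun τ ↦ 2 * etaQuotient 20 (expFn [(1, -1), (4, 1), (5, 5), (20, -5)]) τ
      - 2 * etaQuotient 20 (expFn [(2, -1), (4, 1), (10, 5), (20, -5)]) τ - 4)
    (mdifferentiable_etaQuotient 20 _) ?_ (fun γ hγ τ ↦ x20_smul ⟨γ, hγ⟩ τ)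
    (fun γ hγ τ ↦ by simp only [x20_smul ⟨γ, hγ⟩ τ, y20_smul ⟨γ, hγ⟩ τ])
    (fun γ hγ ↦ isBoundedAtImInfty_x20_smul hγ) (fun γ hγ ↦ ?_) hT1
  · exact (((mdifferentiable_etaQuotient 20 _).const_smul (2 : ℂ)).sub
      ((mdifferentiable_etaQuotient 20 _).const_smul (2 : ℂ))).sub mdifferentiable_const
  · exact (((isBoundedAtImInfty_y20_smul hγ).const_mul_left 2).sub
      ((isBoundedAtImInfty_x20_smul hγ).const_mul_left 2)).sub (const_boundedAtFilter atImInfty (4 : ℂ))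

/-- **(I2b) from (T2)₂₀**: `y′ = −2πi φ₂₀ · (3x² + 2y)` on `ℍ`. [folklore] -/
theorem deriv_y20_of_tendsto
    (hT2 : Tendsto (fun τ : ℍ ↦ ((2 * π * I)⁻¹
      * deriv (etaQuotient 20 (expFn [(1, -1), (4, 1), (5, 5), (20, -5)]) ∘ ofComplex) τ
      + cuspFormEtaProductTwenty τ * (3 * etaQuotient 20 (expFn [(2, -1), (4, 1), (10, 5), (20, -5)]) τ ^ 2
        + 2 * etaQuotient 20 (expFn [(1, -1), (4, 1), (5, 5), (20, -5)]) τ))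
      / Function.Periodic.qParam 1 (τ : ℂ)) atImInfty (𝓝 0)) :
    ∀ τ : ℍ, deriv (etaQuotient 20 (expFn [(1, -1), (4, 1), (5, 5), (20, -5)]) ∘ ofComplex) τ
      = -(2 * π * I * cuspFormEtaProductTwenty τ)
          * (3 * etaQuotient 20 (expFn [(2, -1), (4, 1), (10, 5), (20, -5)]) τ ^ 2
            + 2 * etaQuotient 20 (expFn [(1, -1), (4, 1), (5, 5), (20, -5)]) τ) := by
  refine deriv_eq_of_tendsto_of cuspFormEtaProductTwenty cuspForm_twenty_eq_zero_of_tendsto _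
    (fun τ ↦ 3 * etaQuotient 20 (expFn [(2, -1), (4, 1), (10, 5), (20, -5)]) τ ^ 2
      + 2 * etaQuotient 20 (expFn [(1, -1), (4, 1), (5, 5), (20, -5)]) τ)
    (mdifferentiable_etaQuotient 20 _) ?_ (fun γ hγ τ ↦ y20_smul ⟨γ, hγ⟩ τ)
    (fun γ hγ τ ↦ by simp only [x20_smul ⟨γ, hγ⟩ τ, y20_smul ⟨γ, hγ⟩ τ])
    (fun γ hγ ↦ isBoundedAtImInfty_y20_smul hγ) (fun γ hγ ↦ ?_) hT2
  · exact (((mdifferentiable_etaQuotient 20 _).pow 2).const_smul (3 : ℂ)).add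
      ((mdifferentiable_etaQuotient 20 _).const_smul (2 : ℂ))
  · exact ((((isBoundedAtImInfty_x20_smul hγ).mul (isBoundedAtImInfty_x20_smul hγ)).const_mul_left 3).add
      ((isBoundedAtImInfty_y20_smul hγ).const_mul_left 2)).congr_left fun τ ↦ by
        simp only [Pi.mul_apply]; ring

/-- **(I1) from (I2a), (I2b), (T3)₂₀**: `y² − 2xy − 4y = x³` on `ℍ` — the derivative of
`y² − 2xy − 4y − x³` vanishes identically, so it is constant, and it tends to `0` at `i∞`. [folklore] -/
theorem cubic20_of_deriv
    (hx : ∀ τ : ℍ, deriv (etaQuotient 20 (expFn [(2, -1), (4, 1), (10, 5), (20, -5)]) ∘ ofComplex) τ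
      = -(2 * π * I * cuspFormEtaProductTwenty τ)
          * (2 * etaQuotient 20 (expFn [(1, -1), (4, 1), (5, 5), (20, -5)]) τ
            - 2 * etaQuotient 20 (expFn [(2, -1), (4, 1), (10, 5), (20, -5)]) τ - 4))
    (hy : ∀ τ : ℍ, deriv (etaQuotient 20 (expFn [(1, -1), (4, 1), (5, 5), (20, -5)]) ∘ ofComplex) τ
      = -(2 * π * I * cuspFormEtaProductTwenty τ)
          * (3 * etaQuotient 20 (expFn [(2, -1), (4, 1), (10, 5), (20, -5)]) τ ^ 2
            + 2 * etaQuotient 20 (expFn [(1, -1), (4, 1), (5, 5), (20, -5)]) τ))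
    (hT3 : Tendsto (fun τ : ℍ ↦ etaQuotient 20 (expFn [(1, -1), (4, 1), (5, 5), (20, -5)]) τ ^ 2
      - 2 * etaQuotient 20 (expFn [(2, -1), (4, 1), (10, 5), (20, -5)]) τ
        * etaQuotient 20 (expFn [(1, -1), (4, 1), (5, 5), (20, -5)]) τ
      - 4 * etaQuotient 20 (expFn [(1, -1), (4, 1), (5, 5), (20, -5)]) τ
      - etaQuotient 20 (expFn [(2, -1), (4, 1), (10, 5), (20, -5)]) τ ^ 3) atImInfty (𝓝 0)) :
    ∀ τ : ℍ, etaQuotient 20 (expFn [(1, -1), (4, 1), (5, 5), (20, -5)]) τ ^ 2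
      - 2 * etaQuotient 20 (expFn [(2, -1), (4, 1), (10, 5), (20, -5)]) τ
        * etaQuotient 20 (expFn [(1, -1), (4, 1), (5, 5), (20, -5)]) τ
      - 4 * etaQuotient 20 (expFn [(1, -1), (4, 1), (5, 5), (20, -5)]) τ
      = etaQuotient 20 (expFn [(2, -1), (4, 1), (10, 5), (20, -5)]) τ ^ 3 := by
  set X : ℍ → ℂ := etaQuotient 20 (expFn [(2, -1), (4, 1), (10, 5), (20, -5)]) with hX
  set Y : ℍ → ℂ := etaQuotient 20 (expFn [(1, -1), (4, 1), (5, 5), (20, -5)]) with hY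
  have hXd := UpperHalfPlane.mdifferentiable_iff.mp
    (mdifferentiable_etaQuotient 20 (expFn [(2, -1), (4, 1), (10, 5), (20, -5)]))
  have hYd := UpperHalfPlane.mdifferentiable_iff.mp
    (mdifferentiable_etaQuotient 20 (expFn [(1, -1), (4, 1), (5, 5), (20, -5)]))
  have hderiv : ∀ z ∈ {z : ℂ | 0 < z.im}, deriv (fun z : ℂ ↦ (Y ∘ ofComplex) z ^ 2
      - 2 * (X ∘ ofComplex) z * (Y ∘ ofComplex) z - 4 * (Y ∘ ofComplex) z - (X ∘ ofComplex) z ^ 3) z = 0 := by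
    intro z hz
    have h1 : HasDerivAt (X ∘ ofComplex) (deriv (X ∘ ofComplex) z) z :=
      ((hXd z hz).differentiableAt (isOpen_upperHalfPlaneSet.mem_nhds hz)).hasDerivAt
    have h2 : HasDerivAt (Y ∘ ofComplex) (deriv (Y ∘ ofComplex) z) z :=
      ((hYd z hz).differentiableAt (isOpen_upperHalfPlaneSet.mem_nhds hz)).hasDerivAt
    have hPd := (((h2.fun_pow 2).fun_sub ((h1.const_mul 2).fun_mul h2)).fun_sub (h2.const_mul 4)).fun_sub
      (h1.fun_pow 3)
    rw [hPd.deriv]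
    have hx' := hx ⟨z, hz⟩
    have hy' := hy ⟨z, hz⟩
    have hcoe : ((⟨z, hz⟩ : ℍ) : ℂ) = z := rfl
    rw [hcoe] at hx' hy'
    simp only [Function.comp_apply, ofComplex_apply_of_im_pos hz]
    rw [hx', hy']
    push_cast
    ring
  have hPdiff : DifferentiableOn ℂ (fun z : ℂ ↦ (Y ∘ ofComplex) z ^ 2
      - 2 * (X ∘ ofComplex) z * (Y ∘ ofComplex) z - 4 * (Y ∘ ofComplex) z - (X ∘ ofComplex) z ^ 3)
      {z : ℂ | 0 < z.im} :=
    (((hYd.pow 2).sub ((hXd.const_mul 2).mul hYd)).sub (hYd.const_mul 4)).sub (hXd.pow 3)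
  have hconst : ∀ z ∈ {z : ℂ | 0 < z.im}, ∀ w ∈ {z : ℂ | 0 < z.im},
      (fun z : ℂ ↦ (Y ∘ ofComplex) z ^ 2 - 2 * (X ∘ ofComplex) z * (Y ∘ ofComplex) z
        - 4 * (Y ∘ ofComplex) z - (X ∘ ofComplex) z ^ 3) z
        = (fun z : ℂ ↦ (Y ∘ ofComplex) z ^ 2 - 2 * (X ∘ ofComplex) z * (Y ∘ ofComplex) z
        - 4 * (Y ∘ ofComplex) z - (X ∘ ofComplex) z ^ 3) w :=
    fun z hz w hw ↦ isOpen_upperHalfPlaneSet.is_const_of_deriv_eq_zero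
      convex_setOf_im_pos.isPreconnected hPdiff hderiv hz hw
  intro τ
  have hlim : Tendsto (fun σ : ℍ ↦ Y σ ^ 2 - 2 * X σ * Y σ - 4 * Y σ - X σ ^ 3) atImInfty
      (𝓝 (Y τ ^ 2 - 2 * X τ * Y τ - 4 * Y τ - X τ ^ 3)) := by
    refine tendsto_const_nhds.congr fun σ ↦ ?_
    have h := hconst _ τ.im_pos _ σ.im_pos
    simp only [Function.comp_apply, ofComplex_apply] at h
    exact h
  have h0 : Y τ ^ 2 - 2 * X τ * Y τ - 4 * Y τ - X τ ^ 3 = 0 := tendsto_nhds_unique hlim hT3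
  linear_combination h0

end Summit.BirchSwinnertonDyer.BirchSwinnertonDyer.Theorems.ManinLocalTwoThree.LevelTwenty

end
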